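import Summits.CriticalPhenomena.CardyFormulaZ2.Theorems.RectilinearCardy.Negative.RectilinearCardySquareInstance

/-!
# `RectilinearCardy` (crux stmt-CriticalPhenomena-5660): rectangular shells, lattice polygons, and the law as a parameter (part 3)

Continuation of `RectilinearCardyReductions.lean` / `RectilinearCardySquareInstance.lean`
(structure lemmas extracted from the standing disprover's work file
`Cruxes/RectilinearCardy/Disproof.lean`, cycle 2, sorry-free):

* `shell_subset_segments` (a point of a closed axis-parallel rectangle outside the open rectangle
  lies on one of the four closed sides), `isRectilinear_of_frontier_subset_shells` (SHELL
  CRITERION for the hypothesis of the crux), `isRectilinear_of_carrier_eq_interior` (every LATTICE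
  POLYGON — interior of a finite union of closed `δ₀`-squares, the hypothesis of the sibling target
  `CardyLatticePolygon`, stmt-CriticalPhenomena-4781 — is rectilinear; so the crux covers 4781's
  domains, and 4782 / 4783 / 5843 likewise, see the work file §9).
* `hasCrossingLimit_congr_law` (only the values of a scaling law on `(0,1)` matter: the modulus
  lies in `(0,1)`; in particular the junk values of `cardyFunction` outside `[0,1]` are irrelevant
  to the crux), `not_rectilinear_law_of_exists_not_mem` (UNCONDITIONALLY refuted laws: a candidate
  crossing law of rectilinear rectangles cannot leave `(0,1)` anywhere on `(0,1)` — RSW cluster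
  points, `limit_mem_Ioo`, + rectangles realise every modulus, `exists_isRectilinear_modulus_eq`).

References: B. Bollobás, O. Riordan, *Percolation* (2006), Ch. 7 §7.1 [BollobasRiordan2006];
G. Grimmett, *Percolation*, 2nd ed. (1999), §11.7 [GrimmettPercolation1999].
-/

noncomputable section

namespace Summit.CriticalPhenomena.CardyFormulaZ2.Theorems.RectilinearCardy.Negative

open Set Filter Topology Complex
open Literature.Probability.RandomPlanarGeometry
open Literature.Probability.Percolation (bondDomainCrossingProb mem_segment_iff_of_im_eq mem_segment_iff_of_re_eq)
open Summit.CriticalPhenomena.CardyFormulaZ2.Theses.CardyBoundaryCoulombGas (RectilinearCardy)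

/-! ### Rectangular shells -/

/-- A point of a closed axis-parallel rectangle not in the open rectangle lies on one of the four
closed sides. [folklore] -/
theorem shell_subset_segments {x₀ x₁ y₀ y₁ : ℝ} (hx : x₀ ≤ x₁) (hy : y₀ ≤ y₁) {z : ℂ}
    (hz : z ∈ Icc x₀ x₁ ×ℂ Icc y₀ y₁) (hz' : z ∉ Ioo x₀ x₁ ×ℂ Ioo y₀ y₁) :
    z ∈ segment ℝ (⟨x₀, y₀⟩ : ℂ) ⟨x₁, y₀⟩ ∪ segment ℝ (⟨x₀, y₁⟩ : ℂ) ⟨x₁, y₁⟩ ∪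
      segment ℝ (⟨x₀, y₀⟩ : ℂ) ⟨x₀, y₁⟩ ∪ segment ℝ (⟨x₁, y₀⟩ : ℂ) ⟨x₁, y₁⟩ := by
  rw [Complex.mem_reProdIm, mem_Icc, mem_Icc] at hz
  rw [Complex.mem_reProdIm, mem_Ioo, mem_Ioo] at hz'
  obtain ⟨⟨h1, h2⟩, h3, h4⟩ := hz
  simp only [mem_union]
  by_cases hb : z.im = y₀
  · left; left; left
    rw [mem_segment_iff_of_im_eq (p := ⟨x₀, y₀⟩) (q := ⟨x₁, y₀⟩) hx rfl]
    exact ⟨hb, h1, h2⟩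
  by_cases ht : z.im = y₁
  · left; left; right
    rw [mem_segment_iff_of_im_eq (p := ⟨x₀, y₁⟩) (q := ⟨x₁, y₁⟩) hx rfl]
    exact ⟨ht, h1, h2⟩
  by_cases hl : z.re = x₀
  · left; right
    rw [mem_segment_iff_of_re_eq (p := ⟨x₀, y₀⟩) (q := ⟨x₀, y₁⟩) hy rfl]
    exact ⟨hl, h3, h4⟩
  by_cases hr : z.re = x₁
  · right
    rw [mem_segment_iff_of_re_eq (p := ⟨x₁, y₀⟩) (q := ⟨x₁, y₁⟩) hy rfl]
    exact ⟨hr, h3, h4⟩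
  exact absurd ⟨⟨lt_of_le_of_ne h1 (Ne.symm hl), lt_of_le_of_ne h2 hr⟩,
    lt_of_le_of_ne h3 (Ne.symm hb), lt_of_le_of_ne h4 ht⟩ hz'

/-- **Shell criterion.** A conformal rectangle each of whose boundary points lies in some closed
axis-parallel rectangle of a finite family but not in its interior is rectilinear (hypothesis of
the crux `RectilinearCardy`). [folklore] -/
theorem isRectilinear_of_frontier_subset_shells {R : ConformalRectangle}
    (T : Finset (ℝ × ℝ × ℝ × ℝ)) (hT : ∀ t ∈ T, t.1 ≤ t.2.1 ∧ t.2.2.1 ≤ t.2.2.2)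
    (h : ∀ z ∈ frontier R.carrier, ∃ t ∈ T,
      z ∈ Icc t.1 t.2.1 ×ℂ Icc t.2.2.1 t.2.2.2 ∧ z ∉ Ioo t.1 t.2.1 ×ℂ Ioo t.2.2.1 t.2.2.2) :
    IsRectilinear R := by
  classical
  refine ⟨T.biUnion (fun t ↦ {((⟨t.1, t.2.2.1⟩ : ℂ), (⟨t.2.1, t.2.2.1⟩ : ℂ)),
      ((⟨t.1, t.2.2.2⟩ : ℂ), (⟨t.2.1, t.2.2.2⟩ : ℂ)), ((⟨t.1, t.2.2.1⟩ : ℂ), (⟨t.1, t.2.2.2⟩ : ℂ)),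
      ((⟨t.2.1, t.2.2.1⟩ : ℂ), (⟨t.2.1, t.2.2.2⟩ : ℂ))}), ?_, ?_⟩
  · intro q hq
    simp only [Finset.mem_biUnion, Finset.mem_insert, Finset.mem_singleton] at hq
    obtain ⟨t, -, rfl | rfl | rfl | rfl⟩ := hq
    · exact Or.inr rfl
    · exact Or.inr rfl
    · exact Or.inl rfl
    · exact Or.inl rfl
  · intro z hz
    obtain ⟨t, ht, hz1, hz2⟩ := h z hz
    have hseg := shell_subset_segments (hT t ht).1 (hT t ht).2 hz1 hz2
    simp only [mem_iUnion, Finset.mem_biUnion, Finset.mem_insert, Finset.mem_singleton, exists_prop]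
    rcases hseg with ((h1 | h2) | h3) | h4
    · exact ⟨_, ⟨t, ht, Or.inl rfl⟩, h1⟩
    · exact ⟨_, ⟨t, ht, Or.inr (Or.inl rfl)⟩, h2⟩
    · exact ⟨_, ⟨t, ht, Or.inr (Or.inr (Or.inl rfl))⟩, h3⟩
    · exact ⟨_, ⟨t, ht, Or.inr (Or.inr (Or.inr rfl))⟩, h4⟩

/-- **Lattice polygons are rectilinear**: if the carrier is the interior of a finite union of
closed `δ₀`-squares of `δ₀ℤ²` (verbatim the hypothesis of the sibling target `CardyLatticePolygon`,
stmt-CriticalPhenomena-4781, of the routes `CardyPolygonWords` and `CardyGluingRDE`), the boundary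
lies in the finitely many sides of those squares, so the crux `RectilinearCardy` applies to it. [folklore] -/
theorem isRectilinear_of_carrier_eq_interior {R : ConformalRectangle} {δ₀ : ℝ} (hδ₀ : 0 < δ₀)
    {s : Finset (ℤ × ℤ)}
    (hR : R.carrier = interior (⋃ p ∈ s, {z : ℂ | δ₀ * (p.1 : ℝ) ≤ z.re ∧ z.re ≤ δ₀ * ((p.1 : ℝ) + 1) ∧
      δ₀ * (p.2 : ℝ) ≤ z.im ∧ z.im ≤ δ₀ * ((p.2 : ℝ) + 1)})) : IsRectilinear R := by
  classical
  have hSq : ∀ p : ℤ × ℤ, {z : ℂ | δ₀ * (p.1 : ℝ) ≤ z.re ∧ z.re ≤ δ₀ * ((p.1 : ℝ) + 1) ∧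
      δ₀ * (p.2 : ℝ) ≤ z.im ∧ z.im ≤ δ₀ * ((p.2 : ℝ) + 1)} =
      Icc (δ₀ * (p.1 : ℝ)) (δ₀ * ((p.1 : ℝ) + 1)) ×ℂ Icc (δ₀ * (p.2 : ℝ)) (δ₀ * ((p.2 : ℝ) + 1)) := by
    intro p; ext z; simp only [mem_setOf_eq, Complex.mem_reProdIm, mem_Icc]; tauto
  simp only [hSq] at hR
  set K : Set ℂ := ⋃ p ∈ s, Icc (δ₀ * (p.1 : ℝ)) (δ₀ * ((p.1 : ℝ) + 1)) ×ℂ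
    Icc (δ₀ * (p.2 : ℝ)) (δ₀ * ((p.2 : ℝ) + 1)) with hK
  have hKc : IsClosed K := isClosed_biUnion_finset fun p _ ↦ isClosed_Icc.reProdIm isClosed_Icc
  refine isRectilinear_of_frontier_subset_shells
    (s.image fun p : ℤ × ℤ ↦ (δ₀ * (p.1 : ℝ), δ₀ * ((p.1 : ℝ) + 1), δ₀ * (p.2 : ℝ), δ₀ * ((p.2 : ℝ) + 1)))
    ?_ ?_
  · intro t ht
    obtain ⟨p, -, rfl⟩ := Finset.mem_image.1 ht
    constructor <;> nlinarith
  · intro z hz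
    rw [hR] at hz
    have hz1 : z ∈ K := closure_minimal interior_subset hKc hz.1
    have hz2 : z ∉ interior K := by simpa only [interior_interior] using hz.2
    obtain ⟨p, hp, hzp⟩ : ∃ p ∈ s, z ∈ Icc (δ₀ * (p.1 : ℝ)) (δ₀ * ((p.1 : ℝ) + 1)) ×ℂ
        Icc (δ₀ * (p.2 : ℝ)) (δ₀ * ((p.2 : ℝ) + 1)) := by
      simpa only [hK, mem_iUnion, exists_prop] using hz1
    refine ⟨_, Finset.mem_image_of_mem _ hp, hzp, fun hzo ↦ hz2 ?_⟩
    refine interior_maximal ?_ (isOpen_Ioo.reProdIm isOpen_Ioo) hzo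
    intro w hw
    rw [hK]
    simp only [mem_iUnion, exists_prop]
    exact ⟨p, hp, Complex.mem_reProdIm.2 ⟨Ioo_subset_Icc_self hw.1, Ioo_subset_Icc_self hw.2⟩⟩

/-! ### The scaling law as a parameter -/

/-- **Only the values of a scaling law on `(0,1)` matter**: two laws agreeing on `(0,1)` give the
same `HasCrossingLimit` statement for every conformal rectangle (the modulus lies in `(0,1)`). In
particular the junk values of `cardyFunction` outside `[0,1]` (`Real.rpow` of negatives, a possibly
divergent `₂F₁` series) are irrelevant to the crux. [folklore] -/
theorem hasCrossingLimit_congr_law {G G' : ℝ → ℝ} (h : EqOn G G' (Ioo 0 1)) (R : ConformalRectangle)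
    (p : ℝ → ℝ) : R.HasCrossingLimit p G ↔ R.HasCrossingLimit p G' := by
  rw [hasCrossingLimit_iff_modulus, hasCrossingLimit_iff_modulus, h (modulus_mem_Ioo R)]

/-- **Unconditionally refuted laws**: a candidate scaling function `G` taking a value outside
`(0,1)` somewhere on `(0,1)` cannot be the crossing law of the rectilinear conformal rectangles
(RSW non-degeneracy `limit_mem_Ioo` + rectilinear rectangles realise every modulus,
`exists_isRectilinear_modulus_eq`). This is everything the RSW bound can refute: `cardyFunction`
itself maps `(0,1)` into `(0,1)` (`cardyFunction_mem_Ioo`). [folklore] -/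
theorem not_rectilinear_law_of_exists_not_mem {G : ℝ → ℝ}
    (h : ∃ η ∈ Ioo (0 : ℝ) 1, G η ∉ Ioo (0 : ℝ) 1) :
    ¬ ∀ R : ConformalRectangle, IsRectilinear R → R.HasCrossingLimit (bondDomainCrossingProb R) G := by
  rintro hG
  obtain ⟨η, hη, hGη⟩ := h
  obtain ⟨R, hR, rfl⟩ := exists_isRectilinear_modulus_eq hη
  exact hGη (limit_mem_Ioo R (hasCrossingLimit_iff_modulus.1 (hG R hR)))

/-- Example: the linear law `η ↦ 2η` is refuted outright as the crossing law of rectilinear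
rectangles (it leaves `(0,1)` at `η = 3/4`). [folklore] -/
example : ¬ ∀ R : ConformalRectangle, IsRectilinear R →
    R.HasCrossingLimit (bondDomainCrossingProb R) (fun η ↦ 2 * η) :=
  not_rectilinear_law_of_exists_not_mem ⟨3 / 4, by norm_num, by norm_num⟩

end Summit.CriticalPhenomena.CardyFormulaZ2.Theorems.RectilinearCardy.Negative

end
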